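import Mathlib
import Literature.Computability.AlgebraicComplexity.Apolarity
import Literature.Computability.AlgebraicComplexity.ApolarityAction
import Summits.ValiantsHypothesis.ValiantsHypothesis.Theorems.BorderApolarityFixedWitnessObstructionQPLimitIdeal

/-!
# Border apolarity, crux `ToricWitnessObstructionQP` (stmt-ValiantsHypothesis-14753) — line `Sketch`,
# reshape 4: helper `snf_X_mul_mem_initialSpan` (initial spans of annihilators are ideal truncations)

Route `ValiantsHypothesis/BorderApolarity`, crux item `stmt-ValiantsHypothesis-14753`
(`Summit.ValiantsHypothesis.ValiantsHypothesis.Theses.BorderApolarity.ToricWitnessObstructionQP`),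
line `Sketch`, reshape 4 (structure of stable normal forms), wave-4 helper stub
`snf_X_mul_mem_initialSpan`.

For integer weights `w : σ → ℤ` and a form `F`, the *lowest-weight initial span* in degree `k` is
`J'_k := span { wHC_w^ν E | E ∈ Ann_k(F), all w-components of E of weight < ν vanish }`
(`wHC_w^ν = weightedHomogeneousComponent w ν`).  THIS stub: these spans form an ideal truncation,
`X_i · J'_k ⊆ J'_{k+1}`.

Proof.  Multiplication by `X i` is `ℂ`-linear, so by `Submodule.span_induction` it suffices to treat
a generator `wHC_w^ν E`, `E ∈ Ann_k(F)` with vanishing components below `ν`.  Since `X i` is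
`w`-weighted homogeneous of weight `w i`, taking weighted components commutes with it up to the shift
`μ ↦ μ - w i` (`snfid_weightedHomogeneousComponent_X_mul`), so
`X i · wHC_w^ν E = wHC_w^{ν + w i} (X i · E)`, the components of `X i · E` below `ν + w i` vanish,
and `X i · E ∈ Ann_{k+1}(F)` (`X_mul_mem_annihilatorOfDegree`): the image is again a generator.
-/

open MvPolynomial Filter
open scoped BigOperators Matrix
open Literature.Computability.AlgebraicComplexity

-- the mandated summit-side namespace repeats a component by design (single-problem summit)
set_option linter.dupNamespace false

namespace Summit.ValiantsHypothesis.ValiantsHypothesis.Theorems.BorderApolarityToricWitnessObstructionQP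

/-- Weighted components commute with multiplication by a variable up to the weight shift:
`wHC_w^μ (X i · E) = X i · wHC_w^{μ - w i} E` for integer weights (coefficientwise: the exponent `d`
of a monomial of `X i · E` contains `i`, and `weight w d = weight w (d - e_i) + w i`). [folklore] -/
theorem snfid_weightedHomogeneousComponent_X_mul {σ : Type*} (w : σ → ℤ) (i : σ)
    (E : MvPolynomial σ ℂ) (μ : ℤ) :
    weightedHomogeneousComponent w μ (X i * E) =
      X i * weightedHomogeneousComponent w (μ - w i) E := by
  classical
  ext d
  simp only [coeff_weightedHomogeneousComponent, coeff_X_mul']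
  by_cases hi : i ∈ d.support
  · have hd : d - Finsupp.single i 1 + Finsupp.single i 1 = d :=
      tsub_add_cancel_of_le
        (Finsupp.single_le_iff.mpr (Nat.one_le_iff_ne_zero.mpr (Finsupp.mem_support_iff.mp hi)))
    have hw : Finsupp.weight w d = Finsupp.weight w (d - Finsupp.single i 1) + w i := by
      conv_lhs => rw [← hd]
      rw [map_add, Finsupp.weight_single, one_smul]
    simp only [if_pos hi]
    by_cases hμ : Finsupp.weight w (d - Finsupp.single i 1) = μ - w i
    · rw [if_pos hμ, if_pos (by rw [hw, hμ]; exact sub_add_cancel μ (w i))]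
    · rw [if_neg hμ, if_neg]
      intro h
      apply hμ
      rw [← h, hw]
      exact (add_sub_cancel_right _ _).symm
  · simp only [if_neg hi, ite_self]

/-- W4f IDEAL PROPERTY of lowest-weight initial spans of annihilators: multiplying by a variable maps
the degree-`k` initial span into the degree-`k+1` one. [folklore] -/
theorem snf_X_mul_mem_initialSpan : ∀ {σ : Type} [Fintype σ] [DecidableEq σ] (w : σ → ℤ)
    (F : MvPolynomial σ ℂ) (k : ℕ) (i : σ),
    ∀ D ∈ Submodule.span ℂ {D' : MvPolynomial σ ℂ | ∃ E ∈ annihilatorOfDegree F k, ∃ ν : ℤ,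
        D' = weightedHomogeneousComponent w ν E ∧
          ∀ ν' : ℤ, ν' < ν → weightedHomogeneousComponent w ν' E = 0},
      X i * D ∈ Submodule.span ℂ {D' : MvPolynomial σ ℂ | ∃ E ∈ annihilatorOfDegree F (k + 1), ∃ ν : ℤ,
        D' = weightedHomogeneousComponent w ν E ∧
          ∀ ν' : ℤ, ν' < ν → weightedHomogeneousComponent w ν' E = 0} := by
  intro σ _ _ w F k i D hD
  induction hD using Submodule.span_induction with
  | mem D' hD' =>
    obtain ⟨E, hE, ν, rfl, hmin⟩ := hD'
    refine Submodule.subset_span ⟨X i * E,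
      BorderApolarityFixedWitnessObstructionQP.X_mul_mem_annihilatorOfDegree i hE, ν + w i, ?_, ?_⟩
    · rw [snfid_weightedHomogeneousComponent_X_mul, add_sub_cancel_right]
    · intro ν' hν'
      rw [snfid_weightedHomogeneousComponent_X_mul, hmin (ν' - w i) (by omega), mul_zero]
  | zero =>
    rw [mul_zero]
    exact Submodule.zero_mem _
  | add x y _ _ hx hy =>
    rw [mul_add]
    exact Submodule.add_mem _ hx hy
  | smul c x _ hx =>
    rw [mul_smul_comm]
    exact Submodule.smul_mem _ c hx

end Summit.ValiantsHypothesis.ValiantsHypothesis.Theorems.BorderApolarityToricWitnessObstructionQP
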